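import Mathlib
import HarnessLib
import Summits.PneNP.PneNP.Theses.RamseyAliens

/-!
# Line `split-bridge` — the typed decomposition of the deciding crux `NoExtremalPrinter` (stmt-PneNP-2270)
registered as a skeleton ON the crux (route `RamseyAliens`; crux-strategist BC2 redirect, 2026-08-17)

`X = NoExtremalPrinter` is at least as strong as the summit (`closes : PrinterOfPEqNP → X → PneNP`), so by the
human ruling of 2026-08-16 it is carried as a REDIRECT: `X ⇐ X₁ ∧ X₂` with

* `X₁ = ExtremalIncompressible` (stmt-PneNP-2272, crux rank 2, OPEN — the hard half; its own registered skeleton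
  is `Lines/first_moment_wall.lean`: First-Moment Wall E1 + alteration gap E2, `ExtremalIncompressible_of` proved);
* `X₂ = IncompressibleGivesTarget := ExtremalIncompressible → NoExtremalPrinter` (stmt-PneNP-2280, support, OPEN —
  the routine half; its own registered skeleton is `Lines/igt_simulation.lean`: printer-compresses simulation +
  `R(k) − 1` outgrows polynomials, `IncompressibleGivesTarget_of` proved).

This is the bridge shape `T ∧ (T → X)` (FLT ⇐ Modularity ∧ (Modularity ⇒ FLT)); the seam below is modus ponens
(`trivial_seam`, informational).  BC2 (c): the cheap probes `X₁ → PneNP`, `X₁ → X`, `X₂ → PneNP`, `X₂ → X` all FAIL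
(`first | exact? | simpa | (unfold; simpa) | aesop`, rc 1), no landed iff, `X₁` open and substantive; (d): both
pieces have registered skeletons (above).  The route-level `ledger route edit --split NoExtremalPrinter --into
[ExtremalIncompressible, IncompressibleGivesTarget]` was BOUNCED for this seat by the final-cycle rule
(2026-08-15 extend-in-place) and is left to the tenure planner / harness; this skeleton records the same
decomposition on the crux item meanwhile.  The two stubs are the route's own items, verbatim (name-keyed below);
they are closed by the items' proofs (`theorem … : ExtremalIncompressible`, `… : IncompressibleGivesTarget` under
`Theorems/`), not by new mathematics in this file.
-/

set_option linter.dupNamespace false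

namespace Summit.PneNP.PneNP.Cruxes.NoExtremalPrinter.SplitBridge

open Summit.PneNP.PneNP.Theses.RamseyAliens (ExtremalIncompressible NoExtremalPrinter IncompressibleGivesTarget)

/-! ### The registered stubs (`sorry` lives ONLY here) — the two pieces of the split, by name -/

/-- **Stub X₁ — `ExtremalIncompressible` (route item stmt-PneNP-2272, crux rank 2; conjecture-grade, the hard
half).** Exactly extremal `k`-Ramsey colourings of `K_{R(k)−1}` have `K_U^{m^c+c} ≥ ⌈m^δ⌉` for infinitely many `k`.
Plan: `Lines/first_moment_wall.lean` (`ExtremalIncompressible_of : FirstMomentWall → AlterationGap → _`). -/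
theorem stub_extremalIncompressible : ExtremalIncompressible := by
  sorry

/-- **Stub X₂ — `IncompressibleGivesTarget` (route item stmt-PneNP-2280, support; provable now, the routine
half).** `ExtremalIncompressible → NoExtremalPrinter` by universal-machine simulation of the printer and
`R(k) − 1 ≥ 2^{⌊k/4⌋}`.  Plan: `Lines/igt_simulation.lean` (`IncompressibleGivesTarget_of`). -/
theorem stub_incompressibleGivesTarget : IncompressibleGivesTarget := by
  sorry

/-! ### Name-keyed statements of the stubs -/
namespace Registered

/-- Statement of Stub X₁: the route decl `ExtremalIncompressible`. -/
abbrev stub_extremalIncompressible : Prop := ExtremalIncompressible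

/-- Statement of Stub X₂: the route decl `IncompressibleGivesTarget`. -/
abbrev stub_incompressibleGivesTarget : Prop := IncompressibleGivesTarget

end Registered

/-! ### The composition (proved): the split assembly `X₁ → X₂ → X` -/

/-- **`NoExtremalPrinter` from its two pieces** — modus ponens: `IncompressibleGivesTarget` is by definition
`ExtremalIncompressible → NoExtremalPrinter`.  (Same term as the planner's evidence file
`RamseyAliensNoExtremalPrinterSplit.lean`, to be landed under `Theorems/` by any prover as the `--glue-by` of the
route-level split.) -/
theorem NoExtremalPrinter_of
    (hT : Registered.stub_extremalIncompressible) (hBridge : Registered.stub_incompressibleGivesTarget) :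
    NoExtremalPrinter :=
  hBridge hT

end Summit.PneNP.PneNP.Cruxes.NoExtremalPrinter.SplitBridge
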